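import Summits.ABC.IUTFork.Thm311RealInd1StripPacketNormalisationTransferSharp
import HarnessLib

/-!
# [IUTchIII] Thm 3.11 (i) (Ind1)+(Ind2) on a genuine packet of ANY number of factors: [IUTchIV] Prop 1.1 as a BOX bound for every star `⋆`, and the
# UNCONDITIONAL converses of the monomial-floor junction that these boxes yield — `e_{i₀} ∣ v` with ONE failing bit anywhere (the room inequality is
# then SHARP at every factor count), and `e_{i₀} ∣ v + 1` with failing bits at the slot and at one more factor

PROOF-ONLY file (abc-iut cell, Cor. 3.12 sub-crew, seat abc-iut-c312-1 = holder of record of the typed [IUTchIII] Thm. 3.11, gen 19; row «R26 =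
C:ROOM-SHARPNESS», KEY ROOMSHARP, C LEAD ruling C-R171 (a); file (θ)).  TAKES NO SIDE on [IUTchIII] Cor. 3.12.  No definition, no `Prop` fact, NO
`JannsenWingbergMappingClass`: every theorem here is UNCONDITIONAL (failing bits are displayed `hfix` binders, as in p550084 / p554348 / R25 (B)(B′)).
SETTING (R25 (B) p559518 BY NAME).  Genuine packet `X = ⊗_{i∈I} K_{w_i}`, every factor TAME; slot `i₀`, `‖g‖ = p^{−v/E}`, `E = e(w_{i₀}|p)`,
`v − 1 = E·B + r`, `A = (v−1) div E + 1 − |I|`; `H ≤ Aut_{ℚ_p}(X)` factorwise through the realised strip groups; container radius `R = ‖p^{A}‖·∏_i p^{−1/e_i}`.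
* §1 **`normalizedPacket_subset_purePacket_smul_integerPacket_of_star`** — [IUTchIV] Prop. 1.1 (`prop11_holds` BY NAME) at `|I| ≥ 2` factors as a BOX
  bound, for EVERY star `⋆`: `(R_I)^∼ ⊆ ⊗_{i≠⋆} d_i⁻¹·R_I` (`d_i` generators of the differents, `d_⋆ = 1`); `smul_normalizedPacket_subset_starBox` — hence the
  Θ-region `ι_{i₀}(g)·(R_I)^∼` lies in the box `⊗h·R_I`, `h_{i₀} = g·d_{i₀}⁻¹`, `h_i = d_i⁻¹`, `h_⋆ = 1` (tame: `‖d_i‖ = p^{−(e_i−1)/e_i}`, R25 (B)).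
* §2 **`packetHull_orbit_smul_normalizedPacket_subset_polydisc_of_dvd_of_fixesBaseLine_star`** — `E ∣ v` (`r = E − 1`, `v = E·m`) and ONE factor `⋆`
  (the slot allowed) of residue degree one at which NO realised strip automorphism moves `ℤ_p·p` modulo `p·log_p(𝒪^×)`: the `(R_I)^∼`-hull of the `H`-orbit of
  the region lies in the polydisc of radius `R′_⋆ = ‖g‖·∏_{i≠⋆} p^{1−1/e_i}` — the box of star `⋆` has factor balls `p^{m−1}·log_p` at the slot (`p^{m}·𝒪` if
  `⋆ = i₀`), `𝒪_⋆` at `⋆` (depth-`e`, strip-INVARIANT by the failing bit, p550084), `p⁻¹·log_p` elsewhere (strip-stable, p554348 §1), and R25's engine applies.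
  `R′_⋆/R = p^{−(1−1/e_⋆)}` (file (θ′)): at `e_{i₀} ∣ v` R25 (A)'s room inequality `(r+1)/E + Σ_{i∉S} 1/e_i ≤ 1` reads «bits at EVERY factor», and ONE missing
  bit already confines the hull — the room inequality is SHARP AT EVERY FACTOR COUNT there.  `|I| = 2`: R25 (B) §2 (`⋆ = i₁`) and (B′) §3 (`⋆ = i₀`), same radii.
* §3 **`packetHull_orbit_smul_normalizedPacket_subset_polydisc_of_dvd_succ_of_fixesBaseLine_star`** — `E ∣ v + 1` (`r = E − 2`), failing bits at the slot AND
  at a factor `⋆ ≠ i₀`: hull ⊆ polydisc(`‖g‖·∏_{i≠⋆} p^{1−1/e_i}`) (slot ball `p^{m−2}·p·𝒪 = p^{B}·𝒪`, depth-`e`); `R′/R = p^{−(1−1/E−1/e_⋆)}`.  `|I| = 2`: (B′) §4.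
FLAG (honest residual strip, desk-verified; see the LANDED line): for `|I| ≥ 3` the boxes of §1 — even all stars at once — do NOT detect the failure of the
room inequality in the region `{r ≤ E − 3} ∪ {r = E − 2, bit available at the slot}` (e.g. `e = (5,5,5)`, `v = 3`, `S = ∅`: room `6/5 > 1` fails, yet
`∩_⋆ ⊗_{i≠⋆} d_i⁻¹·R_I ⊋ (R_I)^∼` still reaches the container radius); there the converse needs «`(R_I)^∼` = the monomial box of power bases at tame
residue-degree-one packets» (abc-iut-E-t58's box WITHOUT the incongruence hypothesis), NOT typed here.  So: the room inequality is typed SHARP at `r = E − 1`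
for every `|I|`, at `r = E − 2` when the slot lacks the bit, and at `|I| = 2` throughout (R25); the rest of the failing-room region is OPEN as typed.
READING (numbers about OUR typed objects; neutral); which value a bit takes is NOT claimed; HONEST SCOPE as R25 (B): unconditional; OUR typings (THE
equivariant lift, THE logarithm, factorwise action; F-B28-1 untouched); EVEN degree, WILD, `p = 2` outside; equal-AS-TYPED ≠ equal in print; nothing here asserts
that abc is proved or refuted; no side taken on [IUTchIII] Cor. 3.12 / [IUTchIV] Thm. 1.10, on (U) vs (P), or on any author. [claim: Mochizuki2012, status: disputed];
[cite: Mochizuki2012, IUTchIII Thm. 3.11 (i) p. 154; Rmk. 3.9.5 (i) p. 127; Cor. 3.12 Step (xi) p. 183; IUTchIV Prop. 1.1 p. 9, Prop. 1.2 (ii) pp. 10–11, Prop. 1.4 (i) p. 13];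
[cite: DupuyHilado2025, §4.9, §4.12]; [cite: SerreLocalFields1979, Ch. III §6 Prop. 13]. typed ≠ proved.
-/

set_option autoImplicit false

noncomputable section

open Metric Set Bornology Function
open scoped Pointwise TensorProduct NormedField

namespace Summit.ABC.IUTFork.Thm311.Real

open NumberField IsDedekindDomain Literature.NumberTheory.NumberFields Literature.IUT.LogVolume
open Literature.NumberTheory.GaloisRepresentations Literature.NumberTheory.GaloisRepresentations.Ultrametric
open Literature.AnabelianGeometry.AbsoluteAnabelian Literature.IUT.HodgeArakelov
open Literature.IUT.HodgeArakelov.AbsTopMonoids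

/-! ## §1 [IUTchIV] Prop. 1.1 at `|I|` factors as a BOX bound, for every star -/

section Abstract

variable (p : ℕ) [hp : Fact p.Prime] {I : Type} [Fintype I] [DecidableEq I]
variable (k : I → Type) [∀ i, NontriviallyNormedField (k i)] [∀ i, NormedAlgebra ℚ_[p] (k i)]
  [∀ i, IsUltrametricDist (k i)] [∀ i, ProperSpace (k i)]

/-- **[IUTchIV] Prop. 1.1 as a BOX bound at `|I| ≥ 2` factors (UNCONDITIONAL):** for a star `⋆` and generators `d_i` of the differents off `⋆` (`d_⋆ = 1`,
all `d_i ≠ 0`): `(R_I)^∼ ⊆ ⊗(d_i⁻¹)·R_I`, since `⊗(d_i)·(R_I)^∼ ⊆ R_I` (abc-iut-S5 `prop11_holds`). [cite: Mochizuki2012, IUTchIV Prop. 1.1 p. 9] -/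
theorem normalizedPacket_subset_purePacket_smul_integerPacket_of_star (hI : 2 ≤ Fintype.card I) (star : I)
    (d : Π i, Valued.integer (k i)) (hd : ∀ i, i ≠ star → different p (k i) = Ideal.span {d i}) (hds : d star = 1)
    (hd0 : ∀ i, (d i : k i) ≠ 0) :
    (normalizedPacket p k : Set (PacketAlgebra p k)) ⊆ purePacket p k (fun i => ((d i : k i))⁻¹) • (integerPacket p k : Set (PacketAlgebra p k)) := by
  intro x hx
  refine Set.mem_smul_set.mpr ⟨purePacket p k (fun i => (d i : k i)) * x, (prop11_holds p k hI star d hd hds).1 x hx, ?_⟩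
  rw [smul_eq_mul, ← mul_assoc, purePacket_mul]
  have h1 : purePacket p k ((fun i => ((d i : k i))⁻¹) * fun i => (d i : k i)) = 1 := by
    rw [← purePacket_one p k]
    congr 1
    funext i
    simp only [Pi.mul_apply, Pi.one_apply, inv_mul_cancel₀ (hd0 i)]
  rw [h1, one_mul]

/-- **The Θ-region in the box of star `⋆`:** `ι_{i₀}(g)·(R_I)^∼ ⊆ ⊗h·R_I` with `h = (d_i⁻¹)_i[i₀ ↦ g·d_{i₀}⁻¹]` (so `h_⋆ = 1` if `⋆ ≠ i₀`, `h_{i₀} = g` if `⋆ = i₀`).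
[cite: Mochizuki2012, IUTchIV Prop. 1.1 p. 9; IUTchIII Rmk. 3.9.5 (i) p. 127] -/
theorem smul_normalizedPacket_subset_starBox (hI : 2 ≤ Fintype.card I) (star : I)
    (d : Π i, Valued.integer (k i)) (hd : ∀ i, i ≠ star → different p (k i) = Ideal.span {d i}) (hds : d star = 1)
    (hd0 : ∀ i, (d i : k i) ≠ 0) (i₀ : I) (g : k i₀) :
    iota p k i₀ g • (normalizedPacket p k : Set (PacketAlgebra p k)) ⊆
      purePacket p k (update (fun i => ((d i : k i))⁻¹) i₀ (g * ((d i₀ : k i₀))⁻¹)) • (integerPacket p k : Set (PacketAlgebra p k)) := by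
  refine (Set.smul_set_mono (normalizedPacket_subset_purePacket_smul_integerPacket_of_star p k hI star d hd hds hd0)).trans ?_
  rw [smul_smul, iota_mul_purePacket]

end Abstract

/-! ## §2 `E ∣ v`: ONE failing bit at any factor `⋆` confines the hull (UNCONDITIONAL, any number of factors) -/

section Genuine

variable {K : Type} [Field K] [NumberField K] (p : ℕ) [hp : Fact p.Prime]
variable {I : Type} [Fintype I] [DecidableEq I] (w : I → HeightOneSpectrum (𝓞 K)) (hw : ∀ i, ((p : ℕ) : 𝓞 K) ∈ (w i).asIdeal)

/-- **§2 `E ∣ v`, ONE FAILING bit at any factor `⋆` (UNCONDITIONAL, `|I| ≥ 2` factors).**  Every factor tame; `‖g‖ = p^{−v/E}` with `E ∣ v` (`v = E·m`, `r = E − 1`);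
`⋆` a factor (the slot allowed) of residue degree one at which NO realised strip automorphism moves `ℤ_p·p` modulo `p·log_p(𝒪^×)`; `H` factorwise through the
strip groups.  Then the `(R_I)^∼`-hull of the `H`-orbit of `ι_{i₀}(g)·(R_I)^∼` lies in the polydisc of radius `R′_⋆ = ‖g‖·∏_{i≠⋆} p^{1−1/e_i}`: the box of star `⋆`
(§1) has the balls `p^{m−1}·log_p(𝒪_{w_{i₀}}^×)` (if `⋆ ≠ i₀`) / `p^{m}·𝒪_{w_{i₀}}` (if `⋆ = i₀`) at the slot, `𝒪_{w_⋆}` at `⋆`, `p⁻¹·log_p(𝒪_{w_i}^×)` elsewhere —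
log-shell balls are strip-stable (R25 (B) `norm_of_apply_le_of_mem_closure_of_le`), the depth-`e` ball at `⋆` is strip-invariant (p550084) — and R25's engine
bounds the orbit.  Since `R′_⋆/R = p^{−(1−1/e_⋆)}` (file (θ′)), at `e_{i₀} ∣ v` ONE missing bit anywhere breaks the junction identity: R25 (A)'s room inequality
(«bits everywhere» at `r = E − 1`) is SHARP at every factor count.  `|I| = 2`: R25 (B) §2 / (B′) §3. [claim: Mochizuki2012, status: disputed]
[cite: Mochizuki2012, IUTchIII Thm. 3.11 (i) p. 154; Rmk. 3.9.5 (i) p. 127; IUTchIV Prop. 1.1 p. 9, Prop. 1.2 (ii) p. 10] [cite: DupuyHilado2025, §4.9, §4.12] -/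
theorem packetHull_orbit_smul_normalizedPacket_subset_polydisc_of_dvd_of_fixesBaseLine_star (hI : 2 ≤ Fintype.card I) (hp2 : 2 < p)
    (he : ∀ i, absRamificationIdx p (RescaledCompletion K p (w i) (hw i)) ≤ p - 2)
    (i₀ : I) {g : RescaledCompletion K p (w i₀) (hw i₀)} {v : ℤ}
    (hv : ‖g‖ = (p : ℝ) ^ (-(v / (absRamificationIdx p (RescaledCompletion K p (w i₀) (hw i₀)) : ℝ))))
    (hdvd : ((absRamificationIdx p (RescaledCompletion K p (w i₀) (hw i₀)) : ℤ)) ∣ v)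
    (star : I) (hf : (w star).asIdeal.inertiaDeg ℤ = 1)
    (hfix : ∀ ψ ∈ ind1StripOf (w star) (galoisLog (w star)),
      RescaledCompletion.of K p (w star) (hw star) (ψ (p : (w star).adicCompletion K)) - (p : RescaledCompletion K p (w star) (hw star)) ∈
        (p : ℚ_[p]) • logUnits (RescaledCompletion K p (w star) (hw star)))
    (H : Subgroup (PacketAlgebra p (fun i => RescaledCompletion K p (w i) (hw i)) ≃ₗ[ℚ_[p]]
      PacketAlgebra p (fun i => RescaledCompletion K p (w i) (hw i))))
    (hHfac : ∀ γ ∈ H, ∃ δ : Π i, AddAut ((w i).adicCompletion K),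
      (∀ i, δ i ∈ AddSubgroup.closure (G := AddAut ((w i).adicCompletion K)) (ind1StripOf (w i) (galoisLog (w i)))) ∧
      ∀ z : Π i, RescaledCompletion K p (w i) (hw i),
        γ (PiTensorProduct.tprod ℚ_[p] z) =
          PiTensorProduct.tprod ℚ_[p] (fun i => RescaledCompletion.of K p (w i) (hw i)
            (δ i ((RescaledCompletion.of K p (w i) (hw i)).symm (z i))))) :
    packetHull p (fun i => RescaledCompletion K p (w i) (hw i))
        (⋃ γ : H, (γ : PacketAlgebra p (fun i => RescaledCompletion K p (w i) (hw i)) ≃ₗ[ℚ_[p]]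
            PacketAlgebra p (fun i => RescaledCompletion K p (w i) (hw i))) ''
          (iota p (fun i => RescaledCompletion K p (w i) (hw i)) i₀ g •
            (normalizedPacket p (fun i => RescaledCompletion K p (w i) (hw i)) :
              Set (PacketAlgebra p (fun i => RescaledCompletion K p (w i) (hw i)))))) ⊆
      dEquiv p (fun i => RescaledCompletion K p (w i) (hw i)) ⁻¹'
        polydisc (DFac p (fun i => RescaledCompletion K p (w i) (hw i)))
          (fun _ => ‖g‖ * ∏ i ∈ Finset.univ.erase star,
            (p : ℝ) ^ (1 - 1 / (absRamificationIdx p (RescaledCompletion K p (w i) (hw i)) : ℝ))) := by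
  classical
  set k := fun i => RescaledCompletion K p (w i) (hw i) with hk
  set e := fun i => RescaledCompletion.of K p (w i) (hw i) with he_def
  set E : ℕ := absRamificationIdx p (k i₀) with hE
  haveI : Nonempty I := ⟨i₀⟩
  have hP : p.Prime := Fact.out
  have hp0 : (0 : ℝ) < p := by exact_mod_cast hP.pos
  have hpQ : (p : ℚ_[p]) ≠ 0 := by exact_mod_cast hP.ne_zero
  have hei0 : ∀ i, (0 : ℝ) < (absRamificationIdx p (k i) : ℝ) := fun i => by exact_mod_cast absRamificationIdx_pos p (k i)
  obtain ⟨m, hm⟩ := hdvd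
  have hgn : ‖g‖ = (p : ℝ) ^ (-(m : ℝ)) := by
    rw [hv, show (v : ℝ) / (absRamificationIdx p (RescaledCompletion K p (w i₀) (hw i₀)) : ℝ) = (v : ℝ) / (E : ℝ) from rfl, hm]
    push_cast; congr 2; exact mul_div_cancel_left₀ _ (hei0 i₀).ne'
  -- different generators, the star family `δ = d[⋆ ↦ 1]` and the box `⊗h·R_I ⊇ ι_{i₀}(g)·(R_I)^∼`
  choose d hd hd0 hnd using fun i => exists_different_generator_norm_eq p (k i) (he i)
  let δ := update d star 1
  have hδ : ∀ i, i ≠ star → different p (k i) = Ideal.span {δ i} := fun i hi => by simp only [δ, update_of_ne hi]; exact hd i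
  have hδs : δ star = 1 := update_self _ _ _
  have hδ0 : ∀ i, (δ i : k i) ≠ 0 := by
    intro i; by_cases hi : i = star
    · subst hi; rw [hδs]; exact one_ne_zero
    · simp only [δ, update_of_ne hi]; exact hd0 i
  have hnδ : ∀ i, i ≠ star → ‖((δ i : k i))⁻¹‖ = (p : ℝ) ^ (1 - 1 / (absRamificationIdx p (k i) : ℝ)) := by
    intro i hi
    simp only [δ, update_of_ne hi]
    rw [norm_inv, hnd i, ← Real.rpow_neg hp0.le, neg_neg, sub_div, div_self (hei0 i).ne']
  let h : Π i, k i := update (fun i => ((δ i : k i))⁻¹) i₀ (g * ((δ i₀ : k i₀))⁻¹)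
  have hReg := smul_normalizedPacket_subset_starBox p k hI star δ hδ hδs hδ0 i₀ g
  -- radii: depth-`e` ball at `⋆` (content `p^{m−1}` if `⋆ = i₀`, `p⁻¹` otherwise), log-shell balls elsewhere (content `p^{m−1}` at the slot, `p⁻¹` otherwise)
  let cl : I → ℚ_[p] := fun i => if i = i₀ then (p : ℚ_[p]) ^ (m - 1) else (p : ℚ_[p])⁻¹
  have hcl0 : ∀ i, cl i ≠ 0 := fun i => by
    simp only [cl]; split_ifs; exacts [zpow_ne_zero _ hpQ, inv_ne_zero hpQ]
  have hncl : ∀ i, ‖cl i‖ = (p : ℝ) ^ (if i = i₀ then (1 - (m : ℝ)) else 1) := by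
    intro i; simp only [cl]; split_ifs
    · rw [norm_zpow, Padic.norm_p, inv_zpow', ← Real.rpow_intCast]; push_cast; ring_nf
    · rw [norm_inv, Padic.norm_p, inv_inv, Real.rpow_one]
  let ρ : I → ℝ := fun i => if i = star then ‖cl star‖ * (p : ℝ)⁻¹ else ‖cl i‖ * (p : ℝ) ^ (-(1 / (absRamificationIdx p (k i) : ℝ)))
  have hρ0 : ∀ i, 0 ≤ ρ i := fun i => by simp only [ρ]; split_ifs <;> positivity
  -- the box generators lie in the balls
  have hh : ∀ i, ‖h i‖ ≤ ρ i := by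
    intro i
    by_cases hi0 : i = i₀
    · subst hi0
      simp only [h, update_self]
      by_cases his : i = star
      · -- `⋆ = i₀`: `h = g`, ball `p^{m−1}·p⁻¹` (depth-`e`)
        subst his
        simp only [ρ, if_pos rfl]
        rw [hδs, OneMemClass.coe_one, inv_one, mul_one, hgn, hncl, if_pos rfl, ← Real.rpow_neg_one, ← Real.rpow_add hp0]
        ring_nf; exact le_rfl
      · simp only [ρ, if_neg his]
        rw [norm_mul, hnδ i his, hgn, hncl, if_pos rfl, ← Real.rpow_add hp0, ← Real.rpow_add hp0]
        ring_nf; exact le_rfl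
    · simp only [h, update_of_ne hi0]
      by_cases his : i = star
      · subst his
        simp only [ρ, if_pos rfl]
        rw [hδs, OneMemClass.coe_one, inv_one, norm_one, hncl, if_neg hi0, Real.rpow_one, mul_inv_cancel₀ hp0.ne']
      · simp only [ρ, if_neg his]
        rw [hnδ i his, hncl, if_neg hi0, ← Real.rpow_add hp0]
        ring_nf; exact le_rfl
  -- the balls are strip-stable
  have hstab : ∀ i, ∀ γ ∈ AddSubgroup.closure (G := AddAut ((w i).adicCompletion K)) (ind1StripOf (w i) (galoisLog (w i))),
      ∀ y : (w i).adicCompletion K, ‖e i y‖ ≤ ρ i → ‖e i (γ y)‖ ≤ ρ i := by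
    intro i γ hγ y hy
    by_cases his : i = star
    · subst his
      simp only [ρ, if_pos rfl] at hy ⊢
      have hM := image_depthE_ball_eq_of_mem_closure_of_fixesBaseLine (w i) p (hw i) hp2 (he i) hf (hcl0 i) hfix hγ
      have h1 : γ y ∈ γ '' {x | ‖e i x‖ ≤ ‖cl i‖ * (p : ℝ)⁻¹} := ⟨y, hy, rfl⟩
      rw [hM] at h1
      exact h1
    · simp only [ρ, if_neg his] at hy ⊢
      exact norm_of_apply_le_of_mem_closure_of_le p (w i) (hw i) hp2 (he i) (hcl0 i) hγ hy
  -- the radius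
  have hprod : ∏ i, ρ i = ‖g‖ * ∏ i ∈ Finset.univ.erase star, (p : ℝ) ^ (1 - 1 / (absRamificationIdx p (k i) : ℝ)) := by
    rw [← Finset.mul_prod_erase Finset.univ ρ (Finset.mem_univ star)]
    by_cases hs0 : star = i₀
    · -- `⋆ = i₀`: `ρ_⋆ = ‖g‖`, the rest are `p^{1−1/e_i}`
      subst hs0
      have h1 : ρ star = ‖g‖ := by
        simp only [ρ, if_pos rfl]
        rw [hncl, if_pos rfl, hgn, ← Real.rpow_neg_one, ← Real.rpow_add hp0]; ring_nf
      rw [h1]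
      congr 1
      refine Finset.prod_congr rfl fun i hi => ?_
      have hne : i ≠ star := Finset.ne_of_mem_erase hi
      simp only [ρ, if_neg hne]
      rw [hncl, if_neg hne, ← Real.rpow_add hp0]; ring_nf
    · -- `⋆ ≠ i₀`: `ρ_⋆ = 1`, the slot contributes `‖g‖·p^{1−1/E}`
      have h1 : ρ star = 1 := by
        simp only [ρ, if_pos rfl]
        rw [hncl, if_neg hs0, Real.rpow_one, mul_inv_cancel₀ hp0.ne']
      rw [h1, one_mul, ← Finset.mul_prod_erase (Finset.univ.erase star) ρ (Finset.mem_erase.mpr ⟨Ne.symm hs0, Finset.mem_univ i₀⟩),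
        ← Finset.mul_prod_erase (Finset.univ.erase star) _ (Finset.mem_erase.mpr ⟨Ne.symm hs0, Finset.mem_univ i₀⟩), ← mul_assoc]
      congr 1
      · simp only [ρ, if_neg (Ne.symm hs0)]
        rw [hncl, if_pos rfl, hgn, ← Real.rpow_add hp0, ← Real.rpow_add hp0]; ring_nf
      · refine Finset.prod_congr rfl fun i hi => ?_
        have hne0 : i ≠ i₀ := Finset.ne_of_mem_erase hi
        have hnes : i ≠ star := Finset.ne_of_mem_erase (Finset.mem_of_mem_erase hi)
        simp only [ρ, if_neg hnes]
        rw [hncl, if_neg hne0, ← Real.rpow_add hp0]; ring_nf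
  rw [← hprod]
  exact packetHull_iUnion_image_subset_polydisc_of_subset_smul_integerPacket p w hw h ρ hρ0 hh hstab H hHfac hReg

/-! ## §3 `E ∣ v + 1`: failing bits at the slot and at one more factor confine the hull (UNCONDITIONAL, any number of factors) -/

/-- **§3 `E ∣ v + 1`, FAILING bits at the slot `i₀` and at a factor `⋆ ≠ i₀` (UNCONDITIONAL, `|I| ≥ 2` factors).**  Every factor tame; `‖g‖ = p^{−v/E}` with
`E ∣ v + 1` (`v = E·m − 1`, `r = E − 2`); `i₀` and `⋆` of residue degree one with NO realised strip automorphism moving `ℤ_p·p` modulo `p·log_p(𝒪^×)`; `H`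
factorwise through the strip groups.  Then the `(R_I)^∼`-hull of the `H`-orbit of `ι_{i₀}(g)·(R_I)^∼` lies in the polydisc of radius `‖g‖·∏_{i≠⋆} p^{1−1/e_i}`:
the box of star `⋆` has `p^{m−2}·p·𝒪 = p^{B}·𝒪` at the slot and `𝒪` at `⋆` (depth-`e`, strip-invariant, p550084), `p⁻¹·log_p` elsewhere (strip-stable).
`R′/R = p^{−(1−1/E−1/e_⋆)}` (file (θ′)).  `|I| = 2`: R25 (B′) §4. [claim: Mochizuki2012, status: disputed]
[cite: Mochizuki2012, IUTchIII Thm. 3.11 (i) p. 154; Rmk. 3.9.5 (i) p. 127; IUTchIV Prop. 1.1 p. 9] [cite: DupuyHilado2025, §4.9, §4.12] -/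
theorem packetHull_orbit_smul_normalizedPacket_subset_polydisc_of_dvd_succ_of_fixesBaseLine_star (hI : 2 ≤ Fintype.card I) (hp2 : 2 < p)
    (he : ∀ i, absRamificationIdx p (RescaledCompletion K p (w i) (hw i)) ≤ p - 2)
    (i₀ : I) {g : RescaledCompletion K p (w i₀) (hw i₀)} {v : ℤ}
    (hv : ‖g‖ = (p : ℝ) ^ (-(v / (absRamificationIdx p (RescaledCompletion K p (w i₀) (hw i₀)) : ℝ))))
    (hdvd : ((absRamificationIdx p (RescaledCompletion K p (w i₀) (hw i₀)) : ℤ)) ∣ v + 1)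
    (star : I) (hstar : star ≠ i₀)
    (hf₀ : (w i₀).asIdeal.inertiaDeg ℤ = 1) (hfs : (w star).asIdeal.inertiaDeg ℤ = 1)
    (hfix₀ : ∀ ψ ∈ ind1StripOf (w i₀) (galoisLog (w i₀)),
      RescaledCompletion.of K p (w i₀) (hw i₀) (ψ (p : (w i₀).adicCompletion K)) - (p : RescaledCompletion K p (w i₀) (hw i₀)) ∈
        (p : ℚ_[p]) • logUnits (RescaledCompletion K p (w i₀) (hw i₀)))
    (hfixs : ∀ ψ ∈ ind1StripOf (w star) (galoisLog (w star)),
      RescaledCompletion.of K p (w star) (hw star) (ψ (p : (w star).adicCompletion K)) - (p : RescaledCompletion K p (w star) (hw star)) ∈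
        (p : ℚ_[p]) • logUnits (RescaledCompletion K p (w star) (hw star)))
    (H : Subgroup (PacketAlgebra p (fun i => RescaledCompletion K p (w i) (hw i)) ≃ₗ[ℚ_[p]]
      PacketAlgebra p (fun i => RescaledCompletion K p (w i) (hw i))))
    (hHfac : ∀ γ ∈ H, ∃ δ : Π i, AddAut ((w i).adicCompletion K),
      (∀ i, δ i ∈ AddSubgroup.closure (G := AddAut ((w i).adicCompletion K)) (ind1StripOf (w i) (galoisLog (w i)))) ∧
      ∀ z : Π i, RescaledCompletion K p (w i) (hw i),
        γ (PiTensorProduct.tprod ℚ_[p] z) =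
          PiTensorProduct.tprod ℚ_[p] (fun i => RescaledCompletion.of K p (w i) (hw i)
            (δ i ((RescaledCompletion.of K p (w i) (hw i)).symm (z i))))) :
    packetHull p (fun i => RescaledCompletion K p (w i) (hw i))
        (⋃ γ : H, (γ : PacketAlgebra p (fun i => RescaledCompletion K p (w i) (hw i)) ≃ₗ[ℚ_[p]]
            PacketAlgebra p (fun i => RescaledCompletion K p (w i) (hw i))) ''
          (iota p (fun i => RescaledCompletion K p (w i) (hw i)) i₀ g •
            (normalizedPacket p (fun i => RescaledCompletion K p (w i) (hw i)) :
              Set (PacketAlgebra p (fun i => RescaledCompletion K p (w i) (hw i)))))) ⊆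
      dEquiv p (fun i => RescaledCompletion K p (w i) (hw i)) ⁻¹'
        polydisc (DFac p (fun i => RescaledCompletion K p (w i) (hw i)))
          (fun _ => ‖g‖ * ∏ i ∈ Finset.univ.erase star,
            (p : ℝ) ^ (1 - 1 / (absRamificationIdx p (RescaledCompletion K p (w i) (hw i)) : ℝ))) := by
  classical
  set k := fun i => RescaledCompletion K p (w i) (hw i) with hk
  set e := fun i => RescaledCompletion.of K p (w i) (hw i) with he_def
  set E : ℕ := absRamificationIdx p (k i₀) with hE
  haveI : Nonempty I := ⟨i₀⟩
  have hP : p.Prime := Fact.out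
  have hp0 : (0 : ℝ) < p := by exact_mod_cast hP.pos
  have hpQ : (p : ℚ_[p]) ≠ 0 := by exact_mod_cast hP.ne_zero
  have hei0 : ∀ i, (0 : ℝ) < (absRamificationIdx p (k i) : ℝ) := fun i => by exact_mod_cast absRamificationIdx_pos p (k i)
  obtain ⟨m, hm⟩ := hdvd
  have hgn : ‖g‖ = (p : ℝ) ^ (-(m : ℝ) + 1 / (E : ℝ)) := by
    rw [hv, show (v : ℝ) / (absRamificationIdx p (RescaledCompletion K p (w i₀) (hw i₀)) : ℝ) = (v : ℝ) / (E : ℝ) from rfl,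
      show (v : ℝ) = (E : ℝ) * m - 1 by exact_mod_cast (show v = (E : ℤ) * m - 1 by linear_combination hm)]
    congr 1
    rw [sub_div, mul_div_cancel_left₀ (m : ℝ) (hei0 i₀).ne']
    ring
  -- different generators, the star family `δ = d[⋆ ↦ 1]` and the box `⊗h·R_I ⊇ ι_{i₀}(g)·(R_I)^∼`
  choose d hd hd0 hnd using fun i => exists_different_generator_norm_eq p (k i) (he i)
  let δ := update d star 1
  have hδ : ∀ i, i ≠ star → different p (k i) = Ideal.span {δ i} := fun i hi => by simp only [δ, update_of_ne hi]; exact hd i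
  have hδs : δ star = 1 := update_self _ _ _
  have hδ0 : ∀ i, (δ i : k i) ≠ 0 := by
    intro i; by_cases hi : i = star
    · subst hi; rw [hδs]; exact one_ne_zero
    · simp only [δ, update_of_ne hi]; exact hd0 i
  have hnδ : ∀ i, i ≠ star → ‖((δ i : k i))⁻¹‖ = (p : ℝ) ^ (1 - 1 / (absRamificationIdx p (k i) : ℝ)) := by
    intro i hi
    simp only [δ, update_of_ne hi]
    rw [norm_inv, hnd i, ← Real.rpow_neg hp0.le, neg_neg, sub_div, div_self (hei0 i).ne']
  let h : Π i, k i := update (fun i => ((δ i : k i))⁻¹) i₀ (g * ((δ i₀ : k i₀))⁻¹)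
  have hReg := smul_normalizedPacket_subset_starBox p k hI star δ hδ hδs hδ0 i₀ g
  -- radii: depth-`e` balls at `i₀` (content `p^{m−2}`) and at `⋆` (content `p⁻¹`), log-shell balls `p⁻¹·log_p` elsewhere
  let cf : I → ℚ_[p] := fun i => if i = i₀ then (p : ℚ_[p]) ^ (m - 2) else (p : ℚ_[p])⁻¹
  have hcf0 : ∀ i, cf i ≠ 0 := fun i => by
    simp only [cf]; split_ifs; exacts [zpow_ne_zero _ hpQ, inv_ne_zero hpQ]
  have hncf : ∀ i, ‖cf i‖ = (p : ℝ) ^ (if i = i₀ then (2 - (m : ℝ)) else 1) := by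
    intro i; simp only [cf]; split_ifs
    · rw [norm_zpow, Padic.norm_p, inv_zpow', ← Real.rpow_intCast]; push_cast; ring_nf
    · rw [norm_inv, Padic.norm_p, inv_inv, Real.rpow_one]
  let ρ : I → ℝ := fun i => if i = star ∨ i = i₀ then ‖cf i‖ * (p : ℝ)⁻¹
    else ‖(p : ℚ_[p])⁻¹‖ * (p : ℝ) ^ (-(1 / (absRamificationIdx p (k i) : ℝ)))
  have hρ0 : ∀ i, 0 ≤ ρ i := fun i => by simp only [ρ]; split_ifs <;> positivity
  have hnp1 : ‖(p : ℚ_[p])⁻¹‖ = p := by rw [norm_inv, Padic.norm_p, inv_inv]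
  -- the box generators lie in the balls
  have hh : ∀ i, ‖h i‖ ≤ ρ i := by
    intro i
    by_cases hi0 : i = i₀
    · subst hi0
      simp only [h, update_self, ρ, if_pos (Or.inr rfl)]
      rw [norm_mul, hnδ i (Ne.symm hstar), ← hE, hgn, hncf, if_pos rfl, ← Real.rpow_add hp0, ← Real.rpow_neg_one, ← Real.rpow_add hp0]
      ring_nf; exact le_rfl
    · simp only [h, update_of_ne hi0]
      by_cases his : i = star
      · subst his
        simp only [ρ, if_pos (Or.inl rfl)]
        rw [hδs, OneMemClass.coe_one, inv_one, norm_one, hncf, if_neg hi0, Real.rpow_one, mul_inv_cancel₀ hp0.ne']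
      · have hno : ¬ (i = star ∨ i = i₀) := not_or.mpr ⟨his, hi0⟩
        simp only [ρ, if_neg hno]
        rw [hnδ i his, hnp1, sub_eq_add_neg, Real.rpow_add hp0, Real.rpow_one]
  -- the balls are strip-stable
  have hstab : ∀ i, ∀ γ ∈ AddSubgroup.closure (G := AddAut ((w i).adicCompletion K)) (ind1StripOf (w i) (galoisLog (w i))),
      ∀ y : (w i).adicCompletion K, ‖e i y‖ ≤ ρ i → ‖e i (γ y)‖ ≤ ρ i := by
    intro i γ hγ y hy
    by_cases hio : i = star ∨ i = i₀
    · simp only [ρ, if_pos hio] at hy ⊢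
      have hfi : (w i).asIdeal.inertiaDeg ℤ = 1 := by rcases hio with rfl | rfl; exacts [hfs, hf₀]
      have hfixi : ∀ ψ ∈ ind1StripOf (w i) (galoisLog (w i)),
          e i (ψ (p : (w i).adicCompletion K)) - (p : k i) ∈ (p : ℚ_[p]) • logUnits (k i) := by
        rcases hio with rfl | rfl; exacts [hfixs, hfix₀]
      have hM := image_depthE_ball_eq_of_mem_closure_of_fixesBaseLine (w i) p (hw i) hp2 (he i) hfi (hcf0 i) hfixi hγ
      have h1 : γ y ∈ γ '' {x | ‖e i x‖ ≤ ‖cf i‖ * (p : ℝ)⁻¹} := ⟨y, hy, rfl⟩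
      rw [hM] at h1
      exact h1
    · simp only [ρ, if_neg hio] at hy ⊢
      exact norm_of_apply_le_of_mem_closure_of_le p (w i) (hw i) hp2 (he i) (inv_ne_zero hpQ) hγ hy
  -- the radius: `ρ_⋆ = 1`, `ρ_{i₀} = ‖g‖·p^{1−1/E}`, the rest `p^{1−1/e_i}`
  have hprod : ∏ i, ρ i = ‖g‖ * ∏ i ∈ Finset.univ.erase star, (p : ℝ) ^ (1 - 1 / (absRamificationIdx p (k i) : ℝ)) := by
    have h1 : ρ star = 1 := by
      simp only [ρ, if_pos (Or.inl rfl)]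
      rw [hncf, if_neg hstar, Real.rpow_one, mul_inv_cancel₀ hp0.ne']
    have hmem : i₀ ∈ Finset.univ.erase star := Finset.mem_erase.mpr ⟨Ne.symm hstar, Finset.mem_univ i₀⟩
    rw [← Finset.mul_prod_erase Finset.univ ρ (Finset.mem_univ star), h1, one_mul, ← Finset.mul_prod_erase _ ρ hmem,
      ← Finset.mul_prod_erase _ _ hmem, ← mul_assoc]
    congr 1
    · simp only [ρ, if_pos (Or.inr rfl)]
      rw [hncf, if_pos rfl, hgn, ← Real.rpow_neg_one, ← Real.rpow_add hp0, ← Real.rpow_add hp0]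
      rw [show (absRamificationIdx p (RescaledCompletion K p (w i₀) (hw i₀)) : ℝ) = (E : ℝ) from rfl]
      ring_nf
    · refine Finset.prod_congr rfl fun i hi => ?_
      have hne0 : i ≠ i₀ := Finset.ne_of_mem_erase hi
      have hnes : i ≠ star := Finset.ne_of_mem_erase (Finset.mem_of_mem_erase hi)
      have hno : ¬ (i = star ∨ i = i₀) := not_or.mpr ⟨hnes, hne0⟩
      simp only [ρ, if_neg hno]
      rw [hnp1, sub_eq_add_neg, Real.rpow_add hp0, Real.rpow_one]
  rw [← hprod]
  exact packetHull_iUnion_image_subset_polydisc_of_subset_smul_integerPacket p w hw h ρ hρ0 hh hstab H hHfac hReg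

end Genuine

end Summit.ABC.IUTFork.Thm311.Real
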